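import Mathlib
import Literature.Probability.Percolation.ConditionalPositiveAssociation
import Literature.Probability.Percolation.KozmaNitzanPinning
import Literature.Probability.Percolation.LongRangeKernelPercolationProofs
import HarnessLib

/-!
# Crux `PercNearOneGluing.NearOneGluing` (stmt-CriticalPhenomena-4574) — sub-goal `depthOneGluing`

Helper file for the crux (lead prover-line-stmt-CriticalPhenomena-4574-0, wave 2, line
`bhk-dyadic-thinning`): proves exactly the registered sub-goal signature; lands with
`--supports stmt-CriticalPhenomena-4574`.  Content: Kozma–Nitzan (arXiv:2401.12397) §3.2,
Lemma 5 and Theorem 4 (pp. 12–14) on the weighted complete graph on `Fin n`, GIVEN KN Lemma 3(i)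
(the hypothesis): condition on the pattern `T` of open pairs of the star `F` of `s` (the
non-loop pairs containing `s`; conditioning = pinning, `prodBernoulli_real_inter_eq_sum_pinW`);
for `T ∋ s(s, v)` Lemma 5 gives `P_{pin T}(a₀ ↔ b) ≤ P_{pin T}(v ↔ b) = P_{pin T}(s ↔ b)` for
the minimiser `a₀` of `a ↦ P_{pin ∅}(a ↔ b)` over `A` (Lemma 3(i) under KN's auxiliary weights
`w'` = `H_ε`: `ε` on `T`, `0` on `F ∖ T`, `w` off `F`; then `ε → 0`); summing over `T`,
`P(s ↔ A, s ↮ b) ≤ P(s ↔ A, a₀ ↮ b) ≤ P(a₀ ↮ b)`.  No new definitions: the star `F` and the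
weights `w'` are carried as hypotheses `hF`, `hw'` and instantiated in the final proof.
-/

namespace Summit.CriticalPhenomena.PercolationContinuityZ3.Theorems

open scoped BigOperators Classical
open MeasureTheory Set
open Literature.Probability.LatticeModels (prodBernoulli)
open Literature.Probability.Percolation (openConn openConnIn openCluster
  measurableSet_openConn_holds)

namespace DepthOneGluing

open Literature.Probability.LatticeModels Literature.Probability.Percolation

variable {n : ℕ} {w w' : Sym2 (Fin n) → unitInterval} {s : Fin n} {F T : Finset (Sym2 (Fin n))}
  {ε : unitInterval}

/-- In the star `F` of `s`, `s(s, x) ∈ F` iff `x ≠ s`. [folklore] -/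
theorem mk_mem_star (hF : ∀ e, e ∈ F ↔ s ∈ e ∧ ¬ e.IsDiag) {x : Fin n} :
    s(s, x) ∈ F ↔ x ≠ s := by
  simp [hF, ne_comm]

/-- Every star pair is `s(s, x)` for some `x ≠ s`. [folklore] -/
theorem exists_of_mem_star (hF : ∀ e, e ∈ F ↔ s ∈ e ∧ ¬ e.IsDiag) {e : Sym2 (Fin n)}
    (he : e ∈ F) : ∃ x, x ≠ s ∧ e = s(s, x) := by
  obtain ⟨hs, hd⟩ := (hF e).1 he
  obtain ⟨x, rfl⟩ := Sym2.mem_iff_exists.1 hs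
  exact ⟨x, fun hxs => hd (Sym2.mk_isDiag_iff.2 hxs.symm), rfl⟩

/-- An open path from `s` to a vertex `a ≠ s` starts with an open star pair. [folklore] -/
theorem exists_mem_star_of_reachable (hF : ∀ e, e ∈ F ↔ s ∈ e ∧ ¬ e.IsDiag)
    {ω : Set (Sym2 (Fin n))} {a : Fin n} (has : a ≠ s) (h : (openGraph ω).Reachable s a) :
    ∃ e ∈ F, e ∈ ω := by
  obtain ⟨p⟩ := h
  cases p with
  | nil => exact absurd rfl has
  | cons hadj _ =>
    obtain ⟨hmem, hne⟩ := (openGraph_adj ω _ _).1 hadj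
    exact ⟨_, (mk_mem_star hF).2 (Ne.symm hne), hmem⟩

/-- The event "some pair of `F` is open" is determined by `F`. [folklore] -/
theorem determinedBy_exists_mem (F : Finset (Sym2 (Fin n))) :
    DeterminedBy {ω : Set (Sym2 (Fin n)) | ∃ e ∈ F, e ∈ ω} (↑F : Set (Sym2 (Fin n))) := by
  rw [determinedBy_iff]
  intro ω ω' h
  simp only [Set.mem_setOf_eq]
  refine exists_congr fun e => and_congr_right fun he => ?_
  simpa [he] using Set.ext_iff.1 h e

/-- A cylinder whose pattern contains a weight-zero pair is null. [folklore] -/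
theorem real_localCylinder_eq_zero (hTF : T ⊆ F) {e : Sym2 (Fin n)} (heT : e ∈ T)
    (hwe : w e = 0) : (prodBernoulli w).real (localCylinder (↑F : Set (Sym2 (Fin n))) ↑T) = 0 := by
  rw [prodBernoulli_real_localCylinder]
  refine Finset.prod_eq_zero (hTF heT) ?_
  rw [if_pos (Finset.mem_coe.2 heT), hwe]
  rfl

/-! KN's auxiliary weights `w' = H_ε` (the graph `H` of the proof of Lemma 5, p. 13): `ε` on the
pairs of the pattern `T`, `0` on the other pairs of `F`, `w` off `F` — hypothesis `hw'`. -/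

/-- The total auxiliary weight of `F` is at most `|F| ε`. [folklore] -/
theorem sum_auxW_le (hw' : ∀ e, w' e = if e ∈ F then (if e ∈ T then ε else 0) else w e) :
    ∑ e ∈ F, (w' e : ℝ) ≤ F.card * ε := by
  rw [← nsmul_eq_mul, ← Finset.sum_const]
  refine Finset.sum_le_sum fun e he => ?_
  rw [hw' e, if_pos he]
  split_ifs
  exacts [le_rfl, ε.2.1]

/-- Pinning `F` erases the auxiliary modification. [folklore] -/
theorem pinW_auxW (hw' : ∀ e, w' e = if e ∈ F then (if e ∈ T then ε else 0) else w e)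
    (ξ : Set (Sym2 (Fin n))) : pinW w' ↑F ξ = pinW w ↑F ξ := by
  funext e
  by_cases he : e ∈ F
  · simp [pinW_apply, he]
  · simp [pinW_apply, he, hw' e]

/-- The weights with the whole star closed lie below the auxiliary weights. [folklore] -/
theorem pinW_empty_le_auxW (hw' : ∀ e, w' e = if e ∈ F then (if e ∈ T then ε else 0) else w e) :
    pinW w ↑F ∅ ≤ w' := by
  intro e
  by_cases he : e ∈ F
  · rw [pinW_apply_of_mem_of_not_mem w (Finset.mem_coe.2 he) (Set.notMem_empty e)]
    exact (w' e).2.1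
  · rw [pinW_apply_of_not_mem w ∅ (fun h => he (Finset.mem_coe.1 h)), hw' e, if_neg he]

/-- **KN p. 13, "the probability in `H` has a difference of `Cε` from `G ∖ {0}`"**: under `H_ε`
every event has probability at most its probability with the whole star closed plus `|F| ε`
(split along the cylinder "`F` closed"; off it some pair of `F` is open: union bound).
[cite: KozmaNitzan2024, §3.2 p. 13 (proof of Lemma 5)] -/
theorem real_le_pin_empty_add
    (hw' : ∀ e, w' e = if e ∈ F then (if e ∈ T then ε else 0) else w e)
    (X : Set (Set (Sym2 (Fin n)))) :
    (prodBernoulli w').real X ≤ (prodBernoulli (pinW w ↑F ∅)).real X + F.card * ε := by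
  rw [← measureReal_inter_add_sdiff (μ := prodBernoulli w') (s := X)
    (t := localCylinder (↑F : Set (Sym2 (Fin n))) (∅ : Set (Sym2 (Fin n))))
    MeasurableSet.of_discrete (measure_ne_top _ _)]
  refine add_le_add ?_ ?_
  · rw [prodBernoulli_real_inter_localCylinder _ F ∅ MeasurableSet.of_discrete, pinW_auxW hw']
    exact mul_le_of_le_one_left measureReal_nonneg measureReal_le_one
  · refine (measureReal_mono ?_).trans
      ((prodBernoulli_real_exists_mem_le_sum _ F).trans (sum_auxW_le hw'))
    rintro ω ⟨-, hω⟩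
    simp only [Set.mem_setOf_eq]
    by_contra h
    push Not at h
    exact hω fun e he => iff_of_false (h e (Finset.mem_coe.1 he)) (Set.notMem_empty e)

/-- Under `H_ε` the pairs of `F ∖ T` are a.s. closed, so "all pairs of `T` open" is a.s. the
cylinder `[T]_F`, whence `P_{H_ε}(X ∩ {T open}) = P_{H_ε}([T]_F) · P_{pin T}(X)` (conditioning
on `F` is pinning, and pinning `H_ε` is pinning `w`).
[cite: KozmaNitzan2024, §3.2 p. 13 (proof of Lemma 5, independence from σ)] -/
theorem real_inter_allOpen
    (hw' : ∀ e, w' e = if e ∈ F then (if e ∈ T then ε else 0) else w e) (hT : T ⊆ F)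
    (X : Set (Set (Sym2 (Fin n)))) :
    (prodBernoulli w').real (X ∩ {ω | (↑T : Set (Sym2 (Fin n))) ⊆ ω}) =
      (prodBernoulli w').real (localCylinder (↑F : Set (Sym2 (Fin n))) ↑T) *
        (prodBernoulli (pinW w ↑F ↑T)).real X := by
  have hae : ∀ᵐ ω ∂prodBernoulli w', ∀ e ∈ (↑F : Set (Sym2 (Fin n))) \ ↑T, e ∉ ω :=
    prodBernoulli_ae_forall_notMem _ (Set.toFinite _).countable fun e he => by
      rw [hw' e, if_pos (Finset.mem_coe.1 he.1), if_neg (fun h => he.2 (Finset.mem_coe.2 h))]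
  have h1 : (prodBernoulli w').real (X ∩ {ω | (↑T : Set (Sym2 (Fin n))) ⊆ ω}) =
      (prodBernoulli w').real (X ∩ localCylinder (↑F : Set (Sym2 (Fin n))) ↑T) := by
    refine measureReal_congr ?_
    filter_upwards [hae] with ω hω
    refine propext ⟨fun h => ⟨h.1, fun e he => ?_⟩, fun h => ⟨h.1, fun e heT => ?_⟩⟩
    · by_cases heT : e ∈ T
      · exact iff_of_true (h.2 (Finset.mem_coe.2 heT)) (Finset.mem_coe.2 heT)
      · exact iff_of_false (hω e ⟨he, fun h' => heT (Finset.mem_coe.1 h')⟩)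
          (fun h' => heT (Finset.mem_coe.1 h'))
    · exact (h.2 e (Finset.mem_coe.2 (hT (Finset.mem_coe.1 heT)))).2 heT
  rw [h1, prodBernoulli_real_inter_localCylinder _ F _ MeasurableSet.of_discrete, pinW_auxW hw']

/-- Under `H_ε` (`ε > 0`) the cylinder `[T]_F` has positive probability. [folklore] -/
theorem real_localCylinder_auxW_pos
    (hw' : ∀ e, w' e = if e ∈ F then (if e ∈ T then ε else 0) else w e) (hε : 0 < (ε : ℝ)) :
    0 < (prodBernoulli w').real (localCylinder (↑F : Set (Sym2 (Fin n))) ↑T) := by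
  rw [prodBernoulli_real_localCylinder]
  refine Finset.prod_pos fun e he => ?_
  by_cases heT : e ∈ T
  · simp [hw' e, he, heT, hε]
  · simp [hw' e, he, heT]

/-- The event "all pairs of `T` are open" (`T` a star pattern through `s(s, v)`) is increasing in
the open edge cluster `C_v` (KN p. 14: "`E` is the event that all edges between `0` and `B` are
open … `C_b`-monotone"). [cite: KozmaNitzan2024, §3.2 p. 14] -/
theorem allOpen_mono (hF : ∀ e, e ∈ F ↔ s ∈ e ∧ ¬ e.IsDiag) {v : Fin n} (hT : T ⊆ F)
    (hv : s(s, v) ∈ T) :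
    ∀ ω ω' : Set (Sym2 (Fin n)),
      ω ∈ {ω : Set (Sym2 (Fin n)) | (↑T : Set (Sym2 (Fin n))) ⊆ ω} →
        openEdgeCluster ω v ⊆ openEdgeCluster ω' v →
          ω' ∈ {ω : Set (Sym2 (Fin n)) | (↑T : Set (Sym2 (Fin n))) ⊆ ω} := by
  intro ω ω' hω hsub e heT
  have hadj : ∀ x, s(s, x) ∈ T → (openGraph ω).Adj s x := fun x hx =>
    (openGraph_adj ω s x).2 ⟨hω (Finset.mem_coe.2 hx), ((mk_mem_star hF).1 (hT hx)).symm⟩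
  have hvs : (openGraph ω).Reachable v s := (hadj v hv).symm.reachable
  refine openEdgeCluster_subset ω' v (hsub ?_)
  obtain ⟨x, hxs, rfl⟩ := exists_of_mem_star hF (hT heT)
  rw [mem_openEdgeCluster_iff]
  refine ⟨hω (Finset.mem_coe.2 heT), fun hd => hxs (Sym2.mk_isDiag_iff.1 hd).symm,
    fun y hy => ?_⟩
  rcases Sym2.mem_iff.1 hy with rfl | rfl
  · exact hvs
  · exact hvs.trans (hadj _ heT).reachable

/-- **Core of KN Lemma 5 at fixed `ε`**: the instance of Lemma 3(i) under `H_ε` for the event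
"all pairs of `T` open", divided by `P_{H_ε}([T]_F) > 0`, reads
`P_{pin T}(a₀ ↔ b) ≤ P_{pin T}(v ↔ b) + d`.
[cite: KozmaNitzan2024, §3.2 pp. 13–14 (proof of Lemma 5)] -/
theorem pin_le_pin_add (hw' : ∀ e, w' e = if e ∈ F then (if e ∈ T then ε else 0) else w e)
    (hT : T ⊆ F) (hε : 0 < (ε : ℝ)) {a₀ v b : Fin n} {d : ℝ}
    (h3 : (prodBernoulli w').real (openConn a₀ b ∩ {ω | (↑T : Set (Sym2 (Fin n))) ⊆ ω}) ≤
      (prodBernoulli w').real (openConn v b ∩ {ω | (↑T : Set (Sym2 (Fin n))) ⊆ ω}) +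
        d * (prodBernoulli w').real {ω | (↑T : Set (Sym2 (Fin n))) ⊆ ω}) :
    (prodBernoulli (pinW w ↑F ↑T)).real (openConn a₀ b) ≤
      (prodBernoulli (pinW w ↑F ↑T)).real (openConn v b) + d := by
  have hE := real_inter_allOpen hw' hT Set.univ
  rw [Set.univ_inter, probReal_univ, mul_one] at hE
  rw [real_inter_allOpen hw' hT, real_inter_allOpen hw' hT, hE] at h3
  refine le_of_mul_le_mul_left (h3.trans_eq ?_) (real_localCylinder_auxW_pos hw' hε)
  ring

/-- **KN p. 13, the two `Cε`-comparisons**: if `P_{pin ∅}(a₀ ↔ b) ≤ P_{pin ∅}(v ↔ b)`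
(connections avoiding the star), then `P_{H_ε}(a₀ ↔ b) ≤ P_{H_ε}(v ↔ b) + |F| ε` (the second
comparison is the monotone coupling `pin ∅ ≤ H_ε`).
[cite: KozmaNitzan2024, §3.2 p. 13 (proof of Lemma 5)] -/
theorem real_openConn_auxW_le
    (hw' : ∀ e, w' e = if e ∈ F then (if e ∈ T then ε else 0) else w e) {a₀ v : Fin n} (b : Fin n)
    (hq : (prodBernoulli (pinW w ↑F ∅)).real (openConn a₀ b) ≤
      (prodBernoulli (pinW w ↑F ∅)).real (openConn v b)) :
    (prodBernoulli w').real (openConn a₀ b) ≤ (prodBernoulli w').real (openConn v b) + F.card * ε :=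
  calc (prodBernoulli w').real (openConn a₀ b)
        ≤ (prodBernoulli (pinW w ↑F ∅)).real (openConn a₀ b) + F.card * ε :=
          real_le_pin_empty_add hw' _
    _ ≤ (prodBernoulli (pinW w ↑F ∅)).real (openConn v b) + F.card * ε := by gcongr
    _ ≤ (prodBernoulli w').real (openConn v b) + F.card * ε := by
          gcongr
          exact prodBernoulli_real_mono_of_isUpperSet (pinW_empty_le_auxW hw')
            (isUpperSet_openConn v b) MeasurableSet.of_discrete

/-- `ε → 0`: a bound `P ≤ Q + N ε` for every `ε ∈ (0, 1]` gives `P ≤ Q`. [folklore] -/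
theorem le_of_forall_unitInterval {P Q : ℝ} (N : ℕ)
    (h : ∀ ε : unitInterval, 0 < (ε : ℝ) → P ≤ Q + N * ε) : P ≤ Q := by
  refine le_of_forall_pos_le_add fun δ hδ => ?_
  have hN : (0 : ℝ) < N + 1 := by positivity
  have he0 : 0 < min 1 (δ / (N + 1)) := lt_min one_pos (div_pos hδ hN)
  have hNe : (N : ℝ) * min 1 (δ / (N + 1)) ≤ δ :=
    (mul_le_mul_of_nonneg_left (min_le_right _ _) N.cast_nonneg).trans
      (by rw [mul_div_assoc', div_le_iff₀ hN]; nlinarith)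
  have := h ⟨min 1 (δ / (N + 1)), he0.le, min_le_left _ _⟩ he0
  exact this.trans (by simp only; linarith)

/-- **KN Lemma 5** (pinned form): for a star pattern `T ∋ s(s, v)`, the core inequality
`P_{pin T}(a₀ ↔ b) ≤ P_{pin T}(v ↔ b)` gives `P_{pin T}(a₀ ↔ b) ≤ P_{pin T}(s ↔ b)`, because
under `pin T` the pair `s(s, v)` is a.s. open. [cite: KozmaNitzan2024, §3.2 Lemma 5 (p. 12)] -/
theorem lemma5 (hF : ∀ e, e ∈ F ↔ s ∈ e ∧ ¬ e.IsDiag) {v : Fin n} (hT : T ⊆ F)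
    (hv : s(s, v) ∈ T) {a₀ b : Fin n}
    (hcore : (prodBernoulli (pinW w ↑F ↑T)).real (openConn a₀ b) ≤
      (prodBernoulli (pinW w ↑F ↑T)).real (openConn v b)) :
    (prodBernoulli (pinW w ↑F ↑T)).real (openConn a₀ b) ≤
      (prodBernoulli (pinW w ↑F ↑T)).real (openConn s b) := by
  refine hcore.trans_eq ?_
  rw [← prodBernoulli_pinW_real_inter_localCylinder w F.finite_toSet.countable ↑T (openConn v b),
    ← prodBernoulli_pinW_real_inter_localCylinder w F.finite_toSet.countable ↑T (openConn s b)]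
  congr 1
  ext ω
  simp only [Set.mem_inter_iff]
  refine and_congr_left fun hω => ?_
  have hadj : (openGraph ω).Adj s v := (openGraph_adj ω s v).2
    ⟨(hω _ (Finset.mem_coe.2 (hT hv))).2 (Finset.mem_coe.2 hv), ((mk_mem_star hF).1 (hT hv)).symm⟩
  exact ⟨fun h => hadj.reachable.trans h, fun h => hadj.symm.reachable.trans h⟩

/-- **`{s ↔ A}` is, up to a null set, "some star pair is open"** when `s ∉ A` and every
positive-weight star pair goes to `A`; hence `P({s ↔ A} ∩ X) = P(X ∩ {some star pair open})`.
[cite: KozmaNitzan2024, §3.2 p. 14 (proof of Theorem 4, "E ⊂ {0 ↔ A}")] -/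
theorem real_iUnion_openConn_inter (hF : ∀ e, e ∈ F ↔ s ∈ e ∧ ¬ e.IsDiag) {A : Finset (Fin n)}
    (hsA : s ∉ A) (hiso : ∀ x : Fin n, x ∉ A → x ≠ s → w s(s, x) = 0)
    (X : Set (Set (Sym2 (Fin n)))) :
    (prodBernoulli w).real ((⋃ a ∈ A, openConn s a) ∩ X) =
      (prodBernoulli w).real (X ∩ {ω | ∃ e ∈ F, e ∈ ω}) := by
  apply le_antisymm
  · refine measureReal_mono ?_
    rintro ω ⟨hU, hX⟩
    obtain ⟨a, ha, hsa⟩ := Set.mem_iUnion₂.1 hU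
    exact ⟨hX, exists_mem_star_of_reachable hF (fun h => hsA (h ▸ ha)) hsa⟩
  · have hZ : prodBernoulli w {ω | ∀ e ∈ {e : Sym2 (Fin n) | w e = 0}, e ∉ ω}ᶜ = 0 := by
      rw [Set.compl_setOf]
      exact ae_iff.1 (prodBernoulli_ae_forall_notMem w (Set.toFinite _).countable fun e he => he)
    calc (prodBernoulli w).real (X ∩ {ω | ∃ e ∈ F, e ∈ ω})
          = (prodBernoulli w).real (X ∩ {ω | ∃ e ∈ F, e ∈ ω} ∩
              {ω | ∀ e ∈ {e : Sym2 (Fin n) | w e = 0}, e ∉ ω}) := by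
            rw [measureReal_def, measureReal_def, measure_inter_conull hZ]
      _ ≤ (prodBernoulli w).real ((⋃ a ∈ A, openConn s a) ∩ X) := by
            refine measureReal_mono ?_
            rintro ω ⟨⟨hX, e, he, heω⟩, hZ⟩
            obtain ⟨x, hxs, rfl⟩ := exists_of_mem_star hF he
            have hxA : x ∈ A := by_contra fun hxA => hZ _ (hiso x hxA hxs) heω
            refine ⟨Set.mem_iUnion₂.2 ⟨x, hxA, ?_⟩, hX⟩
            exact ((openGraph_adj ω s x).2 ⟨heω, hxs.symm⟩).reachable

/-- **Summation of Lemma 5 over the star patterns** (KN p. 14, proof of Theorem 4): if the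
pinned comparison `P_{pin T}(a₀ ↔ b) ≤ P_{pin T}(s ↔ b)` holds for every star pattern `T`
through some `s(s, v)` all of whose pairs have non-zero weight, then
`P(a₀ ↔ b, some star pair open) ≤ P(s ↔ b, some star pair open)` (patterns with a weight-zero
pair have null cylinders). [cite: KozmaNitzan2024, §3.2 p. 14 (proof of Theorem 4)] -/
theorem real_openConn_inter_le (hF : ∀ e, e ∈ F ↔ s ∈ e ∧ ¬ e.IsDiag) {a₀ b : Fin n}
    (hcore : ∀ T ⊆ F, ∀ v : Fin n, s(s, v) ∈ T → (∀ e ∈ T, w e ≠ 0) →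
      (prodBernoulli (pinW w ↑F ↑T)).real (openConn a₀ b) ≤
        (prodBernoulli (pinW w ↑F ↑T)).real (openConn s b)) :
    (prodBernoulli w).real (openConn a₀ b ∩ {ω | ∃ e ∈ F, e ∈ ω}) ≤
      (prodBernoulli w).real (openConn s b ∩ {ω | ∃ e ∈ F, e ∈ ω}) := by
  rw [prodBernoulli_real_inter_eq_sum_pinW w F MeasurableSet.of_discrete
      (determinedBy_exists_mem _),
    prodBernoulli_real_inter_eq_sum_pinW w F MeasurableSet.of_discrete
      (determinedBy_exists_mem _)]
  refine Finset.sum_le_sum fun T hT => ?_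
  -- (the filter carries the classical decidability instance of the cited lemma)
  obtain ⟨hTF, hTB⟩ :=
    (@Finset.mem_filter _ _ (fun _ => Classical.propDecidable _) _ _).1 hT
  have hTF' : T ⊆ F := Finset.mem_powerset.1 hTF
  by_cases h0 : ∃ e ∈ T, w e = 0
  · obtain ⟨e, heT, hwe⟩ := h0
    rw [real_localCylinder_eq_zero hTF' heT hwe, zero_mul, zero_mul]
  · push Not at h0
    obtain ⟨e₀, he₀F, he₀T⟩ := hTB
    obtain ⟨v, -, rfl⟩ := exists_of_mem_star hF he₀F
    exact mul_le_mul_of_nonneg_left (hcore T hTF' v (Finset.mem_coe.1 he₀T) h0)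
      measureReal_nonneg

end DepthOneGluing

open DepthOneGluing Literature.Probability.LatticeModels
  Literature.Probability.Percolation in
/-- Kozma–Nitzan arXiv:2401.12397 Theorem 4 (p. 12) / Lemma 5, consequence: ADDITIVE GLUING AT
DEPTH ONE — if every positive-weight non-loop edge at `s` goes to `A`, then
`P(s ↔ A, s ↮ b) ≤ max_{a∈A} P(a ↮ b)` (here: `≤ t` for any common bound `t`). Takes KN
Lemma 3(i) as hypothesis. [cite: KozmaNitzan2024, Theorem 4 and Lemma 5] -/
theorem depthOneGluing :
    (∀ (n : ℕ) (w : Sym2 (Fin n) → unitInterval) (a₁ a₂ b : Fin n)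
      (Q : Set (Literature.Probability.Percolation.BondConfig (Fin n))) (d : ℝ),
      (∀ ω ω', ω ∈ Q → Literature.Probability.Percolation.openEdgeCluster ω a₂ ⊆
          Literature.Probability.Percolation.openEdgeCluster ω' a₂ → ω' ∈ Q) →
      0 ≤ d →
      (Literature.Probability.LatticeModels.prodBernoulli w).real
          (Literature.Probability.Percolation.openConn a₁ b) ≤
        (Literature.Probability.LatticeModels.prodBernoulli w).real
          (Literature.Probability.Percolation.openConn a₂ b) + d →
      (Literature.Probability.LatticeModels.prodBernoulli w).real
          (Literature.Probability.Percolation.openConn a₁ b ∩ Q) ≤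
        (Literature.Probability.LatticeModels.prodBernoulli w).real
          (Literature.Probability.Percolation.openConn a₂ b ∩ Q) +
          d * (Literature.Probability.LatticeModels.prodBernoulli w).real Q) →
    ∀ (n : ℕ) (w : Sym2 (Fin n) → unitInterval) (A : Finset (Fin n)) (s b : Fin n) (t : ℝ),
      0 ≤ t →
      (∀ x : Fin n, x ∉ A → x ≠ s → w s(s, x) = 0) →
      (∀ a ∈ A, (Literature.Probability.LatticeModels.prodBernoulli w).real
          (Literature.Probability.Percolation.openConn a b)ᶜ ≤ t) →
      (Literature.Probability.LatticeModels.prodBernoulli w).real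
          ((⋃ a ∈ A, Literature.Probability.Percolation.openConn s a) ∩
            (Literature.Probability.Percolation.openConn s b)ᶜ) ≤ t := by
  intro H n w A s b t ht hiso hrel
  -- `s ∈ A`: `{s ↔ A}` is everything and `P(s ↮ b) ≤ t` is a hypothesis.
  by_cases hsA : s ∈ A
  · exact (measureReal_mono Set.inter_subset_right).trans (hrel s hsA)
  rcases A.eq_empty_or_nonempty with rfl | hAne
  · have h0 : (⋃ a ∈ (∅ : Finset (Fin n)), openConn s a : Set (Set (Sym2 (Fin n)))) = ∅ :=
      by simp
    rw [h0, Set.empty_inter, measureReal_empty]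
    exact ht
  -- the star `F` of `s` and the minimiser `a₀ ∈ A` of `a ↦ P_{pin ∅}(a ↔ b)` (star closed)
  set F : Finset (Sym2 (Fin n)) := Finset.univ.filter fun e => s ∈ e ∧ ¬ e.IsDiag with hFd
  have hF : ∀ e, e ∈ F ↔ s ∈ e ∧ ¬ e.IsDiag := fun e => by simp [hFd]
  obtain ⟨a₀, ha₀, hmin⟩ := A.exists_min_image (fun a =>
    (prodBernoulli (pinW w ↑F (∅ : Set (Sym2 (Fin n))))).real (openConn a b)) hAne
  -- KN Theorem 4 (Lemma 5 summed over the star patterns, `a₀` the minimiser of Lemma 5)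
  have key : (prodBernoulli w).real ((⋃ a ∈ A, openConn s a) ∩ openConn a₀ b) ≤
      (prodBernoulli w).real ((⋃ a ∈ A, openConn s a) ∩ openConn s b) := by
    rw [real_iUnion_openConn_inter hF hsA hiso, real_iUnion_openConn_inter hF hsA hiso]
    refine real_openConn_inter_le hF fun T hTF v hvT h0 => ?_
    have hvs : v ≠ s := (mk_mem_star hF).1 (hTF hvT)
    have hvA : v ∈ A := by_contra fun hvA => h0 _ hvT (hiso v hvA hvs)
    refine lemma5 hF hTF hvT (le_of_forall_unitInterval F.card fun ε hε => ?_)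
    -- KN's auxiliary weights `H_ε`
    let w' : Sym2 (Fin n) → unitInterval := fun e => if e ∈ F then (if e ∈ T then ε else 0) else w e
    have hw' : ∀ e, w' e = if e ∈ F then (if e ∈ T then ε else 0) else w e := fun e => rfl
    exact pin_le_pin_add hw' hTF hε (H n w' a₀ v b
      {ω : Set (Sym2 (Fin n)) | (↑T : Set (Sym2 (Fin n))) ⊆ ω} (F.card * ε)
      (allOpen_mono hF hTF hvT) (mul_nonneg (Nat.cast_nonneg _) ε.2.1)
      (real_openConn_auxW_le hw' b (hmin v hvA)))
  have e1 := measureReal_inter_add_sdiff (μ := prodBernoulli w) (s := ⋃ a ∈ A, openConn s a)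
    (t := openConn s b) MeasurableSet.of_discrete (measure_ne_top _ _)
  have e2 := measureReal_inter_add_sdiff (μ := prodBernoulli w) (s := ⋃ a ∈ A, openConn s a)
    (t := openConn a₀ b) MeasurableSet.of_discrete (measure_ne_top _ _)
  calc (prodBernoulli w).real ((⋃ a ∈ A, openConn s a) ∩ (openConn s b)ᶜ)
        = (prodBernoulli w).real ((⋃ a ∈ A, openConn s a) \ openConn s b) := by
          rw [Set.sdiff_eq]
    _ ≤ (prodBernoulli w).real ((⋃ a ∈ A, openConn s a) \ openConn a₀ b) := by linarith
    _ ≤ (prodBernoulli w).real (openConn a₀ b)ᶜ := measureReal_mono fun ω hω => hω.2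
    _ ≤ t := hrel a₀ ha₀

end Summit.CriticalPhenomena.PercolationContinuityZ3.Theorems
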